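import Summits.CriticalPhenomena.PercolationContinuityZ3.Theorems.Transplant.SkelPhiRunKitClauseGHab
import Summits.CriticalPhenomena.PercolationContinuityZ3.Theorems.Transplant.SkelPhiRunKits
import HarnessLib

/-!
# N1 (the `{±1}` node), LEVEL 1, kit adapter file N-K8d: **`hkits_runXGHab` / `hkits_runYGHab`** — the habitat twins of `hkits_runXG/YG` (exploration
# graph `winGraphIn G Ω`, levels `winLevelIn`, weighting `IsSubbox (winGraphIn G Ω) Wt q Dr`), ABSTRACT exit pieces

builds on p205010 (kernel theorem, internal audit signed; external expert review pending) — nothing in this file uses p205010; nothing here is a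
claim about the open node `SamePDropOfSkeletonNeg`.
Lane `prim-bschramm`, seat `prim-bschramm-p1` (gen 11; design KIT-APRON-N1); helper file (`--supports stmt-CriticalPhenomena-4575 --as helper`).
* **`hkits_runXGHab`**, **`hkits_runYGHab`**.
[cite: KozmaNitzan2024, §4 Lemma 10 (pp. 17–21); Lemma 11 (pp. 22–23)] [cite: MartineauTassion2017, §4.3 Lemma 4.2]
-/

noncomputable section

open scoped Classical

namespace Summit.CriticalPhenomena.PercolationContinuityZ3.Theorems.Transplant

namespace Skelφ

open MeasureTheory
open Literature.Probability.Percolation Literature.Probability.LatticeModels SimpleGraph KNLevels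
open Literature.Barriers.CriticalPhenomena (graphBall graphBall_finite mem_graphBall_self graphBall_mono)
open Skel (winGraph winGraph_adj winGraph_le winGraphIn winGraphIn_le KitGeom)
open SkelI (tanOff tanTgt tanTgt_mem)
open Literature.Probability.Percolation.KozmaNitzan.Cells (oth oth_ne eq_oth_of_ne oth_oth)

variable {V : Type} [DecidableEq V] {G : SimpleGraph V} [G.LocallyFinite] {ψ φ : V → Site 2}

/-- **THE KIT CLAUSE OF AN x-RUN LEVEL OVER A HABITAT FROM THE INPUTS AT EVERY CENTRE, ABSTRACT exit pieces** (`hkits` of `kitsAt_stepAF` at level `j` of step `k`): the window is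
the run frame `runX φ c₀ n_L h_L σ` around `w₀` (radius `R`), the level box is `[lo k − j, hi k + j]` of `xRunSched n_L ℓ_L h_L R′ qB Nr`, the
region `Dr ⊇ Win(region k)` carries the subbox weighting `Wt`, the target `T ⊇ Win(core (k+1)) ∪ (far part of the level)`; inputs at every
centre `c`: the zone `(M_u)`, the eight short exit links (pieces `pexX`), the two long x-links (side halves `σ`, `τ = ±1`).
[cite: KozmaNitzan2024, §4 Lemma 10 (pp. 17–21)] [cite: MartineauTassion2017, §4.3 Lemma 4.2] -/
theorem hkits_runXGHab [Countable V] {types : Finset V} (hlipφ : Lip G φ) (hstep : Steps G φ) (hfr : Frames G φ types) (hκ : CylConn G φ types)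
    {Δ : ℕ} (hΔ : ∀ v, G.degree v ≤ Δ) {q : unitInterval} {δ : ℝ} (hδ : 0 < δ)
    -- the run: long data, frame, schedule
    {nL : ℕ} (hnL : 1 ≤ nL) (c₀ : V) (hL : ℤ) {σ : ℤ} (hσ : σ = 1 ∨ σ = -1) {kq : ℕ} (hκL : hL.natAbs ≤ kq * nL) (ℓL R's qB Nr : ℕ)
    {k j : ℕ} {w₀ : V} {R r Rl Mz : ℕ}
    -- kit constants
    (P : ApronPrm) {Rs Kmax KCmax rs cS cU : ℕ} (hPN : kq + 3 ≤ P.N) (hA : P.A = (Mz + 1 : ℕ) * (shearUnit nL hL : ℤ) + 1)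
    (hd1 : P.W + P.ℓ ≤ P.d) (hD1 : P.W + P.ℓ + P.d + 2 ≤ shellD P) (hD2 : P.ℓ + Rs + P.d + 3 ≤ shellD P) (hDρ : Rs + 1 ≤ shellD P)
    (hℓ : 1 ≤ P.ℓ) (hW : Rs + P.ℓ ≤ P.W) (hKmax : (shellD P + P.W) * (kq + 1) ≤ Kmax) (hKCmax : (shellD P + Mz + 1) * (kq + 1) ≤ KCmax)
    (hR' : cylRadMax G φ types P.ℓ (Rs + KCmax + (P.W + Kmax)) ≤ P.R')
    (hwide : ∀ i, ((xRunSched nL ℓL hL R's qB Nr).lo k - (j : Site 2)) i + 2 * tanOff P.ℓs P.M ≤ ((xRunSched nL ℓL hL R's qB Nr).hi k + (j : Site 2)) i)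
    (hdw : ∀ i, ((xRunSched nL ℓL hL R's qB Nr).lo k - (j : Site 2)) i + (P.d + 2 : ℕ) ≤ ((xRunSched nL ℓL hL R's qB Nr).hi k + (j : Site 2)) i)
    (hDw : ∀ i, ((xRunSched nL ℓL hL R's qB Nr).lo k - (j : Site 2)) i + ((shellD P + 1 + P.d + KCmax + Rs : ℕ) : ℤ) ≤
      ((xRunSched nL ℓL hL R's qB Nr).hi k + (j : Site 2)) i)
    (hT : (P.W : ℤ) + Kmax + P.ℓ + 1 ≤ tanOff P.ℓs P.M) (hT' : (shellD P : ℤ) + KCmax + Rs ≤ tanOff P.ℓs P.M)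
    (hr₀ : P.N * (tanOff P.ℓs P.M + 2) + P.N * P.d + (P.W + Kmax + P.R') + (KCmax + Rs) ≤ P.r₀) (hR : P.r₀ ≤ R)
    (hrs : 2 * (1 + P.N * (tanOff P.ℓs P.M + 2) + P.N * P.d + (P.W + Kmax + P.R') + (KCmax + Rs)) ≤ rs)
    (hcS : (P.N + 1) * (tanOff P.ℓs P.M + 1) + (P.N + 1) * P.d + (2 * P.W + 1) * (Kmax + 1) * (Δ + 1) ^ P.R' ≤ cS)
    -- the reach of the kit centre: inside the `R′`-enlargement, and `B(w₀, R − r)` with `Rl ≤ r ≤ R`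
    (hE : j + (P.N * (tanOff P.ℓs P.M + 1) + P.N * P.d + KCmax) ≤ (xRunSched nL ℓL hL R's qB Nr).R')
    (hreach : r + (P.N * (tanOff P.ℓs P.M + 1) + P.N * P.d + KCmax) ≤ P.r₀) (hr : Rl ≤ r) (hrR : r ≤ R)
    -- the short region, the zone family, the short pieces
    (Rg : V → Finset V) (hRg : ∀ c, ∀ u ∈ Rg c, u ∈ graphBall G c Rs) (hRgcard : ∀ c, (Rg c).card ≤ cU) (hcU1 : 1 ≤ cU)
    (Λc : V → ℕ → Finset V) (kz : ℕ) (hkn : ∀ c, Λc c kz ⊆ Λc c Mz) (hΛ : ∀ c, ∀ v ∈ Λc c Mz, v ∈ Rg c ∧ φ v - φ c ∈ box 2 Mz)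
    (hZ : ∀ c, (↑(Λc c Mz) : Set V) ⊆ cyl φ c Mz) (hMz : Mz < nL)
    (Pex : Fin 2 → ℤˣ → V → Finset V)
    (hPex : ∀ (i : Fin 2) (σ₀ : ℤˣ) (c : V), ∀ v ∈ Pex i σ₀ c, v ∈ Rg c ∧
      (runXSideU (φ := φ) c₀ hnL hL hσ ((xRunSched nL ℓL hL R's qB Nr).lo k - (j : Site 2)) ((xRunSched nL ℓL hL R's qB Nr).hi k + (j : Site 2)) i σ₀).lin (φ v) + P.A +
        ((runXSideU (φ := φ) c₀ hnL hL hσ ((xRunSched nL ℓL hL R's qB Nr).lo k - (j : Site 2)) ((xRunSched nL ℓL hL R's qB Nr).hi k + (j : Site 2)) i σ₀).s : ℤ) *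
          coef (runXSideU (φ := φ) c₀ hnL hL hσ ((xRunSched nL ℓL hL R's qB Nr).lo k - (j : Site 2)) ((xRunSched nL ℓL hL R's qB Nr).hi k + (j : Site 2)) i σ₀).cα
            (runXSideU (φ := φ) c₀ hnL hL hσ ((xRunSched nL ℓL hL R's qB Nr).lo k - (j : Site 2)) ((xRunSched nL ℓL hL R's qB Nr).hi k + (j : Site 2)) i σ₀).cβ
            (runXSideU (φ := φ) c₀ hnL hL hσ ((xRunSched nL ℓL hL R's qB Nr).lo k - (j : Site 2)) ((xRunSched nL ℓL hL R's qB Nr).hi k + (j : Site 2)) i σ₀).a ≤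
      (runXSideU (φ := φ) c₀ hnL hL hσ ((xRunSched nL ℓL hL R's qB Nr).lo k - (j : Site 2)) ((xRunSched nL ℓL hL R's qB Nr).hi k + (j : Site 2)) i σ₀).lin (φ c))
    -- the level's source/support, the weighting on the region, the target
    {Ω : Finset V} (hfull : winLevel G (runX φ c₀ nL hL σ) w₀ R ((xRunSched nL ℓL hL R's qB Nr).lo k) ((xRunSched nL ℓL hL R's qB Nr).hi k) j ⊆ Ω)
    (kk : ℕ) (o : V) (Sfin : Finset V) {Wt : Sym2 V → unitInterval} {Dr T : Finset V} (hDrΩ : Dr ⊆ Ω) (hWD : IsSubbox (winGraphIn G Ω) Wt q Dr)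
    (hPD : Win G (runX φ c₀ nL hL σ) w₀ ((xRunSched nL ℓL hL R's qB Nr).region k) R ⊆ Dr)
    (hXD : winLevelIn (runX φ c₀ nL hL σ) Ω ((xRunSched nL ℓL hL R's qB Nr).lo k) ((xRunSched nL ℓL hL R's qB Nr).hi k) j ⊆ Dr)
    (hPT : Win G (runX φ c₀ nL hL σ) w₀ ((xRunSched nL ℓL hL R's qB Nr).core (k + 1)) R ⊆ T)
    (hpadT : ∀ x ∈ outerBoundary (winGraphIn G Ω) (winLevelIn (runX φ c₀ nL hL σ) Ω ((xRunSched nL ℓL hL R's qB Nr).lo k) ((xRunSched nL ℓL hL R's qB Nr).hi k) j),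
      x ∉ outerBoundary (winGraph G w₀ R) (winLevel G (runX φ c₀ nL hL σ) w₀ R ((xRunSched nL ℓL hL R's qB Nr).lo k) ((xRunSched nL ℓL hL R's qB Nr).hi k) j) →
      inNbrIn G (runX φ c₀ nL hL σ) Ω (Finset.Icc ((xRunSched nL ℓL hL R's qB Nr).lo k - (j : Site 2)) ((xRunSched nL ℓL hL R's qB Nr).hi k + (j : Site 2))) x ∈ T)
    (hfarT : ∀ v ∈ winLevel G (runX φ c₀ nL hL σ) w₀ R ((xRunSched nL ℓL hL R's qB Nr).lo k) ((xRunSched nL ℓL hL R's qB Nr).hi k) j,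
      v ∉ graphBall G w₀ (R - P.r₀) → v ∈ T)
    {N : ℕ} (hN : kk * (Δ + 1) ^ (2 * rs) ≤ N) (hk : (1 - (q : ℝ) ^ (1 + Δ * cS + cS * cU)) ^ kk ≤ δ)
    -- THE INPUTS AT EVERY CENTRE: zone, short exit links, long x-links
    (hzone : ∀ c, 1 - δ ^ 2 < (bondPercolation G q).real (UniqZone.zone G (Λc c) kz Mz))
    (hexit : ∀ c (i : Fin 2) (σ₀ : ℤˣ), 1 - δ ^ 2 < (bondPercolation G q).real (linkIn (↑(Rg c) : Set V) (Λc c kz) (Pex i σ₀ c)))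
    (hlong : ∀ c (τ : ℤ), τ = 1 ∨ τ = -1 → 1 - δ ^ 2 < (bondPercolation G q).real
      (linkIn (pgramPrism G φ c nL hL (3 * ℓL) Rl) (Λc c kz) (pgSideHalfW G φ c nL hL ℓL Rl σ (σ * τ)))) :
    ∃ (σ' : SData V) (S : Finset V),
      SHyp (winLDataIn G (runX φ c₀ nL hL σ) Ω ((xRunSched nL ℓL hL R's qB Nr).lo k) ((xRunSched nL ℓL hL R's qB Nr).hi k) o Sfin) j σ' ∧
      σ'.N ≤ N ∧ (1 - (q : ℝ) ^ σ'.sB) ^ σ'.k ≤ δ ∧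
      S ⊆ (winLDataIn G (runX φ c₀ nL hL σ) Ω ((xRunSched nL ℓL hL R's qB Nr).lo k) ((xRunSched nL ℓL hL R's qB Nr).hi k) o Sfin).X j ∧
      S ⊆ Dr ∧ (∀ x ∈ σ'.K, ∀ e ∈ σ'.seed x, e ∉ wireSet (↑S : Set V)) ∧ (∀ x ∈ σ'.K, σ'.face x ⊆ S) ∧
      (∀ x ∈ σ'.K, 1 - 3 * δ ≤ (prodBernoulli Wt).real {ω | ∃ u ∈ σ'.face x,
        1 - δ < (prodBernoulli (pinW Wt (wireSet (↑S : Set V)) ω)).real (⋃ t ∈ T, openConnIn (↑Dr : Set V) u t)}) := by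
  set SN := xRunSched nL ℓL hL R's qB Nr with hSN
  set ψ := runX φ c₀ nL hL σ with hψ
  set SF := runXSideU (φ := φ) c₀ hnL hL hσ (SN.lo k - (j : Site 2)) (SN.hi k + (j : Site 2)) with hSF
  have hKeq : winLevel G ψ w₀ R (SN.lo k) (SN.hi k) j = Win G ψ w₀ (Finset.Icc (SN.lo k - (j : Site 2)) (SN.hi k + (j : Site 2))) R := rfl
  -- the frame facts used for the reach
  have hlip : Lip G ψ := lip_runX hlipφ hσ hnL c₀ hL
  have hq : QStepsN G ψ P.N := (qStepsN_runX hstep hnL c₀ hL hσ hκL).mono hPN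
  have hU1 : (1 : ℤ) ≤ (shearUnit nL hL : ℤ) := by have := shearUnit_pos hnL hL; omega
  have hU : (shearUnit nL hL : ℤ) ≤ ((kq + 1 : ℕ) : ℤ) * nL := by
    have : ((shearUnit nL hL : ℕ) : ℤ) = nL + (hL.natAbs : ℤ) := by unfold shearUnit; push_cast; ring
    rw [this]; push_cast
    have : (hL.natAbs : ℤ) ≤ kq * nL := by exact_mod_cast hκL
    linarith
  have haff : ∀ (i : Fin 2) (σ₀ : ℤˣ), (SF i σ₀).IsAffine (shearUnit nL hL : ℤ) (if i = 0 then (shearUnit nL hL : ℤ) else nL) := fun i σ₀ => by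
    rw [hSF]; exact runXSideU_isAffine c₀ hnL hL hσ _ _ i σ₀
  have hC : ∀ (i : Fin 2) (σ₀ : ℤˣ), (nL : ℤ) ≤ (if i = 0 then (shearUnit nL hL : ℤ) else nL) := fun i σ₀ => by
    split_ifs
    · have : ((shearUnit nL hL : ℕ) : ℤ) = nL + (hL.natAbs : ℤ) := by unfold shearUnit; push_cast; ring
      rw [this]; linarith [Int.natCast_nonneg hL.natAbs]
    · exact le_rfl
  have hKC := hKC_of_affine SF haff hU1 P hnL hC hU hA hKCmax
  refine kitClause_runXGHab hlipφ hstep hfr hκ hΔ hδ hnL c₀ hL hσ hκL P hPN hA hd1 hD1 hD2 hDρ hℓ hW hKmax hKCmax hR' hwide hdw hDw hT hT'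
    hr₀ hR hrs hcS Rg hRg hRgcard hcU1 Λc kz hkn hΛ Pex hPex hfull kk o Sfin hWD hXD hN hk hpadT (fun x hx hfar => ?_)
    (fun x hx hnear => ?_)
  · -- FAR: the inner neighbour lies in the level and outside `B(w₀, R − r₀)`
    refine hfarT _ ?_ hfar
    have h := inNbr_spec (G := G) (φ := ψ) (by rw [hKeq] at hx; exact hx)
    rw [hKeq]
    exact (mem_Win G ψ).2 ⟨h.2.1, h.2.2⟩
  · -- NEAR: zone, exit link, route datum at the kit centre
    refine Or.inr ⟨hzone _, hexit _ _ _, ?_⟩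
    have hx' : x ∈ outerBoundary (winGraph G w₀ R) (Win G ψ w₀ (Finset.Icc (SN.lo k - (j : Site 2)) (SN.hi k + (j : Site 2))) R) := by
      rw [hKeq] at hx; exact hx
    set c := ctCtr G SF P w₀ R x with hc
    -- the centre's frame image and window position
    have hcI : ψ c ∈ Finset.Icc (SN.lo k - ((SN.R' : ℕ) : Site 2)) (SN.hi k + ((SN.R' : ℕ) : Site 2)) :=
      ψ_ctCtr_mem_Icc SF hlip hq hstep hwide (fun i σ₀ z h1 h2 => hKC i σ₀ z h1) hE hx
    have hcw : c ∈ graphBall G w₀ (R - r) := by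
      have hd := ctCtr_reach SF hlip hq hstep hwide (fun i σ₀ z h1 h2 => hKC i σ₀ z h1) hx'
      have h := BoxProdZ2.mem_graphBall_add G hnear hd
      exact graphBall_mono G _ (by omega) h
    exact routeSetsN_xIn (φ := φ) hnL c₀ hL hσ ℓL R's qB Nr hcI hcw hr hrR (hZ c) hMz hPD hPT hDrΩ hWD
      (hlong c _ (ChainPara.RunPrm.steer_eq_or _ _ _))

/-- **THE KIT CLAUSE OF A y′-RUN LEVEL OVER A HABITAT FROM THE INPUTS AT EVERY CENTRE, ABSTRACT exit pieces** (`hkits` of `kitsAt_stepAF` at level `j` of step `k`): the window is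
the run frame `runY φ c₀ n_L h_L σ` around `w₀` (radius `R`), the level box is `[lo k − j, hi k + j]` of `yRunSched … R′ qB Nr` (`|v_L| ≤ n_L`, layer inequality, zone clearance `(Mz+4)(n_L+|h_L|) ≤ n_L(ℓ_L+1)`), the
region `Dr ⊇ Win(region k)` carries the subbox weighting `Wt`, the target `T ⊇ Win(core (k+1)) ∪ (far part of the level)`; inputs at every
centre `c`: the zone `(M_u)`, the eight short exit links (pieces `pexY`), the long y′-links (top pieces `σ`, `τ`, split `v_L`).
[cite: KozmaNitzan2024, §4 Lemma 10 (pp. 17–21)] [cite: MartineauTassion2017, §4.3 Lemma 4.2] -/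
theorem hkits_runYGHab [Countable V] {types : Finset V} (hlipφ : Lip G φ) (hstep : Steps G φ) (hfr : Frames G φ types) (hκ : CylConn G φ types)
    {Δ : ℕ} (hΔ : ∀ v, G.degree v ≤ Δ) {q : unitInterval} {δ : ℝ} (hδ : 0 < δ)
    -- the run: long data, frame, schedule
    {nL : ℕ} (hnL : 1 ≤ nL) (c₀ : V) (hL : ℤ) {σ : ℤ} (hσ : σ = 1 ∨ σ = -1) {kq : ℕ} (hκL : hL.natAbs ≤ kq * nL) {ℓL : ℕ} {vL : ℤ} (hvL : |vL| ≤ nL)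
    (hlay : (nL + hL.natAbs : ℕ) ≤ (nL : ℤ) * ℓL + 1) (R's qB Nr : ℕ)
    {k j : ℕ} {w₀ : V} {R r Rl Mz : ℕ}
    -- kit constants
    (P : ApronPrm) {Rs Kmax KCmax rs cS cU : ℕ} (hPN : kq + 3 ≤ P.N) (hA : P.A = (Mz + 1 : ℕ) * (shearUnit nL hL : ℤ) + 1)
    (hd1 : P.W + P.ℓ ≤ P.d) (hD1 : P.W + P.ℓ + P.d + 2 ≤ shellD P) (hD2 : P.ℓ + Rs + P.d + 3 ≤ shellD P) (hDρ : Rs + 1 ≤ shellD P)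
    (hℓ : 1 ≤ P.ℓ) (hW : Rs + P.ℓ ≤ P.W) (hKmax : (shellD P + P.W) * (kq + 1) ≤ Kmax) (hKCmax : (shellD P + Mz + 1) * (kq + 1) ≤ KCmax)
    (hR' : cylRadMax G φ types P.ℓ (Rs + KCmax + (P.W + Kmax)) ≤ P.R')
    (hwide : ∀ i, ((yRunSched hnL hvL hlay R's qB Nr).lo k - (j : Site 2)) i + 2 * tanOff P.ℓs P.M ≤ ((yRunSched hnL hvL hlay R's qB Nr).hi k + (j : Site 2)) i)
    (hdw : ∀ i, ((yRunSched hnL hvL hlay R's qB Nr).lo k - (j : Site 2)) i + (P.d + 2 : ℕ) ≤ ((yRunSched hnL hvL hlay R's qB Nr).hi k + (j : Site 2)) i)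
    (hDw : ∀ i, ((yRunSched hnL hvL hlay R's qB Nr).lo k - (j : Site 2)) i + ((shellD P + 1 + P.d + KCmax + Rs : ℕ) : ℤ) ≤
      ((yRunSched hnL hvL hlay R's qB Nr).hi k + (j : Site 2)) i)
    (hT : (P.W : ℤ) + Kmax + P.ℓ + 1 ≤ tanOff P.ℓs P.M) (hT' : (shellD P : ℤ) + KCmax + Rs ≤ tanOff P.ℓs P.M)
    (hr₀ : P.N * (tanOff P.ℓs P.M + 2) + P.N * P.d + (P.W + Kmax + P.R') + (KCmax + Rs) ≤ P.r₀) (hR : P.r₀ ≤ R)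
    (hrs : 2 * (1 + P.N * (tanOff P.ℓs P.M + 2) + P.N * P.d + (P.W + Kmax + P.R') + (KCmax + Rs)) ≤ rs)
    (hcS : (P.N + 1) * (tanOff P.ℓs P.M + 1) + (P.N + 1) * P.d + (2 * P.W + 1) * (Kmax + 1) * (Δ + 1) ^ P.R' ≤ cS)
    -- the reach of the kit centre: inside the `R′`-enlargement, and `B(w₀, R − r)` with `Rl ≤ r ≤ R`
    (hE : j + (P.N * (tanOff P.ℓs P.M + 1) + P.N * P.d + KCmax) ≤ (yRunSched hnL hvL hlay R's qB Nr).R')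
    (hreach : r + (P.N * (tanOff P.ℓs P.M + 1) + P.N * P.d + KCmax) ≤ P.r₀) (hr : Rl ≤ r) (hrR : r ≤ R)
    -- the short region, the zone family, the short pieces
    (Rg : V → Finset V) (hRg : ∀ c, ∀ u ∈ Rg c, u ∈ graphBall G c Rs) (hRgcard : ∀ c, (Rg c).card ≤ cU) (hcU1 : 1 ≤ cU)
    (Λc : V → ℕ → Finset V) (kz : ℕ) (hkn : ∀ c, Λc c kz ⊆ Λc c Mz) (hΛ : ∀ c, ∀ v ∈ Λc c Mz, v ∈ Rg c ∧ φ v - φ c ∈ box 2 Mz)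
    (hZ : ∀ c, (↑(Λc c Mz) : Set V) ⊆ cyl φ c Mz) (hclear : (Mz + 4) * (nL + hL.natAbs) ≤ nL * (ℓL + 1))
    (Pex : Fin 2 → ℤˣ → V → Finset V)
    (hPex : ∀ (i : Fin 2) (σ₀ : ℤˣ) (c : V), ∀ v ∈ Pex i σ₀ c, v ∈ Rg c ∧
      (runYSideU (φ := φ) c₀ hnL hL hσ ((yRunSched hnL hvL hlay R's qB Nr).lo k - (j : Site 2)) ((yRunSched hnL hvL hlay R's qB Nr).hi k + (j : Site 2)) i σ₀).lin (φ v) + P.A +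
        ((runYSideU (φ := φ) c₀ hnL hL hσ ((yRunSched hnL hvL hlay R's qB Nr).lo k - (j : Site 2)) ((yRunSched hnL hvL hlay R's qB Nr).hi k + (j : Site 2)) i σ₀).s : ℤ) *
          coef (runYSideU (φ := φ) c₀ hnL hL hσ ((yRunSched hnL hvL hlay R's qB Nr).lo k - (j : Site 2)) ((yRunSched hnL hvL hlay R's qB Nr).hi k + (j : Site 2)) i σ₀).cα
            (runYSideU (φ := φ) c₀ hnL hL hσ ((yRunSched hnL hvL hlay R's qB Nr).lo k - (j : Site 2)) ((yRunSched hnL hvL hlay R's qB Nr).hi k + (j : Site 2)) i σ₀).cβ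
            (runYSideU (φ := φ) c₀ hnL hL hσ ((yRunSched hnL hvL hlay R's qB Nr).lo k - (j : Site 2)) ((yRunSched hnL hvL hlay R's qB Nr).hi k + (j : Site 2)) i σ₀).a ≤
      (runYSideU (φ := φ) c₀ hnL hL hσ ((yRunSched hnL hvL hlay R's qB Nr).lo k - (j : Site 2)) ((yRunSched hnL hvL hlay R's qB Nr).hi k + (j : Site 2)) i σ₀).lin (φ c))
    -- the level's source/support, the weighting on the region, the target
    {Ω : Finset V} (hfull : winLevel G (runY φ c₀ nL hL σ) w₀ R ((yRunSched hnL hvL hlay R's qB Nr).lo k) ((yRunSched hnL hvL hlay R's qB Nr).hi k) j ⊆ Ω)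
    (kk : ℕ) (o : V) (Sfin : Finset V) {Wt : Sym2 V → unitInterval} {Dr T : Finset V} (hDrΩ : Dr ⊆ Ω) (hWD : IsSubbox (winGraphIn G Ω) Wt q Dr)
    (hPD : Win G (runY φ c₀ nL hL σ) w₀ ((yRunSched hnL hvL hlay R's qB Nr).region k) R ⊆ Dr)
    (hXD : winLevelIn (runY φ c₀ nL hL σ) Ω ((yRunSched hnL hvL hlay R's qB Nr).lo k) ((yRunSched hnL hvL hlay R's qB Nr).hi k) j ⊆ Dr)
    (hPT : Win G (runY φ c₀ nL hL σ) w₀ ((yRunSched hnL hvL hlay R's qB Nr).core (k + 1)) R ⊆ T)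
    (hpadT : ∀ x ∈ outerBoundary (winGraphIn G Ω) (winLevelIn (runY φ c₀ nL hL σ) Ω ((yRunSched hnL hvL hlay R's qB Nr).lo k) ((yRunSched hnL hvL hlay R's qB Nr).hi k) j),
      x ∉ outerBoundary (winGraph G w₀ R) (winLevel G (runY φ c₀ nL hL σ) w₀ R ((yRunSched hnL hvL hlay R's qB Nr).lo k) ((yRunSched hnL hvL hlay R's qB Nr).hi k) j) →
      inNbrIn G (runY φ c₀ nL hL σ) Ω (Finset.Icc ((yRunSched hnL hvL hlay R's qB Nr).lo k - (j : Site 2)) ((yRunSched hnL hvL hlay R's qB Nr).hi k + (j : Site 2))) x ∈ T)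
    (hfarT : ∀ v ∈ winLevel G (runY φ c₀ nL hL σ) w₀ R ((yRunSched hnL hvL hlay R's qB Nr).lo k) ((yRunSched hnL hvL hlay R's qB Nr).hi k) j,
      v ∉ graphBall G w₀ (R - P.r₀) → v ∈ T)
    {N : ℕ} (hN : kk * (Δ + 1) ^ (2 * rs) ≤ N) (hk : (1 - (q : ℝ) ^ (1 + Δ * cS + cS * cU)) ^ kk ≤ δ)
    -- THE INPUTS AT EVERY CENTRE: zone, short exit links, long x-links
    (hzone : ∀ c, 1 - δ ^ 2 < (bondPercolation G q).real (UniqZone.zone G (Λc c) kz Mz))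
    (hexit : ∀ c (i : Fin 2) (σ₀ : ℤˣ), 1 - δ ^ 2 < (bondPercolation G q).real (linkIn (↑(Rg c) : Set V) (Λc c kz) (Pex i σ₀ c)))
    (hlong : ∀ c (τ : ℤ), τ = 1 ∨ τ = -1 → 1 - δ ^ 2 < (bondPercolation G q).real
      (linkIn (pgramPrism G φ c nL hL (3 * ℓL) Rl) (Λc c kz) (pgTopPieceW G φ c nL hL ℓL Rl σ τ vL))) :
    ∃ (σ' : SData V) (S : Finset V),
      SHyp (winLDataIn G (runY φ c₀ nL hL σ) Ω ((yRunSched hnL hvL hlay R's qB Nr).lo k) ((yRunSched hnL hvL hlay R's qB Nr).hi k) o Sfin) j σ' ∧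
      σ'.N ≤ N ∧ (1 - (q : ℝ) ^ σ'.sB) ^ σ'.k ≤ δ ∧
      S ⊆ (winLDataIn G (runY φ c₀ nL hL σ) Ω ((yRunSched hnL hvL hlay R's qB Nr).lo k) ((yRunSched hnL hvL hlay R's qB Nr).hi k) o Sfin).X j ∧
      S ⊆ Dr ∧ (∀ x ∈ σ'.K, ∀ e ∈ σ'.seed x, e ∉ wireSet (↑S : Set V)) ∧ (∀ x ∈ σ'.K, σ'.face x ⊆ S) ∧
      (∀ x ∈ σ'.K, 1 - 3 * δ ≤ (prodBernoulli Wt).real {ω | ∃ u ∈ σ'.face x,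
        1 - δ < (prodBernoulli (pinW Wt (wireSet (↑S : Set V)) ω)).real (⋃ t ∈ T, openConnIn (↑Dr : Set V) u t)}) := by
  set SN := yRunSched hnL hvL hlay R's qB Nr with hSN
  set ψ := runY φ c₀ nL hL σ with hψ
  set SF := runYSideU (φ := φ) c₀ hnL hL hσ (SN.lo k - (j : Site 2)) (SN.hi k + (j : Site 2)) with hSF
  have hKeq : winLevel G ψ w₀ R (SN.lo k) (SN.hi k) j = Win G ψ w₀ (Finset.Icc (SN.lo k - (j : Site 2)) (SN.hi k + (j : Site 2))) R := rfl
  -- the frame facts used for the reach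
  have hlip : Lip G ψ := lip_runY hlipφ hσ hnL c₀ hL
  have hq : QStepsN G ψ P.N := (qStepsN_runY hstep hnL c₀ hL hσ hκL).mono hPN
  have hU1 : (1 : ℤ) ≤ (shearUnit nL hL : ℤ) := by have := shearUnit_pos hnL hL; omega
  have hU : (shearUnit nL hL : ℤ) ≤ ((kq + 1 : ℕ) : ℤ) * nL := by
    have : ((shearUnit nL hL : ℕ) : ℤ) = nL + (hL.natAbs : ℤ) := by unfold shearUnit; push_cast; ring
    rw [this]; push_cast
    have : (hL.natAbs : ℤ) ≤ kq * nL := by exact_mod_cast hκL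
    linarith
  have haff : ∀ (i : Fin 2) (σ₀ : ℤˣ), (SF i σ₀).IsAffine (shearUnit nL hL : ℤ) (if i = 0 then (nL : ℤ) else (shearUnit nL hL : ℤ)) := fun i σ₀ => by
    rw [hSF]; exact runYSideU_isAffine c₀ hnL hL hσ _ _ i σ₀
  have hC : ∀ (i : Fin 2) (σ₀ : ℤˣ), (nL : ℤ) ≤ (if i = 0 then (nL : ℤ) else (shearUnit nL hL : ℤ)) := fun i σ₀ => by
    split_ifs
    · exact le_rfl
    · have : ((shearUnit nL hL : ℕ) : ℤ) = nL + (hL.natAbs : ℤ) := by unfold shearUnit; push_cast; ring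
      rw [this]; linarith [Int.natCast_nonneg hL.natAbs]
  have hKC := hKC_of_affine SF haff hU1 P hnL hC hU hA hKCmax
  refine kitClause_runYGHab hlipφ hstep hfr hκ hΔ hδ hnL c₀ hL hσ hκL P hPN hA hd1 hD1 hD2 hDρ hℓ hW hKmax hKCmax hR' hwide hdw hDw hT hT'
    hr₀ hR hrs hcS Rg hRg hRgcard hcU1 Λc kz hkn hΛ Pex hPex hfull kk o Sfin hWD hXD hN hk hpadT (fun x hx hfar => ?_)
    (fun x hx hnear => ?_)
  · -- FAR: the inner neighbour lies in the level and outside `B(w₀, R − r₀)`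
    refine hfarT _ ?_ hfar
    have h := inNbr_spec (G := G) (φ := ψ) (by rw [hKeq] at hx; exact hx)
    rw [hKeq]
    exact (mem_Win G ψ).2 ⟨h.2.1, h.2.2⟩
  · -- NEAR: zone, exit link, route datum at the kit centre
    refine Or.inr ⟨hzone _, hexit _ _ _, ?_⟩
    have hx' : x ∈ outerBoundary (winGraph G w₀ R) (Win G ψ w₀ (Finset.Icc (SN.lo k - (j : Site 2)) (SN.hi k + (j : Site 2))) R) := by
      rw [hKeq] at hx; exact hx
    set c := ctCtr G SF P w₀ R x with hc
    -- the centre's frame image and window position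
    have hcI : ψ c ∈ Finset.Icc (SN.lo k - ((SN.R' : ℕ) : Site 2)) (SN.hi k + ((SN.R' : ℕ) : Site 2)) :=
      ψ_ctCtr_mem_Icc SF hlip hq hstep hwide (fun i σ₀ z h1 h2 => hKC i σ₀ z h1) hE hx
    have hcw : c ∈ graphBall G w₀ (R - r) := by
      have hd := ctCtr_reach SF hlip hq hstep hwide (fun i σ₀ z h1 h2 => hKC i σ₀ z h1) hx'
      have h := BoxProdZ2.mem_graphBall_add G hnear hd
      exact graphBall_mono G _ (by omega) h
    exact routeSetsN_yIn (φ := φ) hnL hvL hlay c₀ hσ R's qB Nr hcI hcw hr hrR (hZ c) hclear hPD hPT hDrΩ hWD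
      (hlong c _ (ChainPara.RunPrm.steer_eq_or _ _ _))

end Skelφ

end Summit.CriticalPhenomena.PercolationContinuityZ3.Theorems.Transplant

end
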